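import Mathlib
import Summits.QuantumFields.BalabanUV.Beta.CoarseCoerciveCovariantEnergy

/-!
# [Balaban1985BackgroundPropagators] (3.32)–(3.35) p. 396 ∕ (3.19) p. 393 — GAUGE COVARIANCE OF THE COARSE SANDWICH AND
# THE UNIFORM-HOLONOMY COROLLARY OF E-I3's ENERGY SIDE: fine gauge rotations leave `Q A⁻¹ Q*` unchanged, coarse relabellings
# conjugate it by a unitary, coercivity constants are invariant under unitary conjugation (so the coercivity of
# `Q_jG(□̃)Q_j*` may be computed in ANY gauge — leaf (g) of NOTE-I3 §5.2); and `coarse_coercive_cov` of the sibling module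
# specialised to a UNIFORM holonomy-defect bound `H` and an out-degree bound `d`:
# `E = μS₁S₂ + (θ₁ + H·S₁)(θ₂ + H·d·S₂)` — the U = 1 four maxima plus `(H, d)` (cell topic
# `Summits/QuantumFields/BalabanUV/Beta`; row-D4 interface item (I3), E-I3 leaves (g), (e2) of NOTE-I3 §5.2)

HONEST FRAMING (cell rule).  Discharging `BetaPertH` makes Bałaban's UV stability UNCONDITIONAL — a real constructive-QFT
result; NOT the continuum limit, NOT the Clay problem.  This module discharges NOTHING of `BetaPertH`.  [folklore] linear
algebra, kernel-checked.  WHY: `CoarseCoerciveCovariantEnergy` (p221805) gives `(δ²∕(μS₁S₂ + θ₁′θ₂′))‖B‖² ≤ Re B*(QA⁻¹Q*)B`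
for Bałaban-type covariant averages with bond-wise holonomy-defect bounds `h b y`.  Two bookkeeping items of NOTE-I3 §5.2
(`HOME/b2b-balaban-beta-an4/g39/NOTE-I3-coarse-coercivity.md`) remained: (g) «by (3.32)∕(3.34) Q_jG(□̃)Q_j* transforms by
conjugation with R(u) on the coarse lattice, an isometry: coercivity constants are gauge invariant, so the cube-wise gauge of
(3.35) may be used cube by cube», and the reading of (e2) «θ₁, θ₂ get multiplied by (1 + O(1)Mα₀)».  Here: (§1) for `U` with
`UᴴU = 1`, `sandwich (U A Uᴴ) (U q) = sandwich A q` LITERALLY (fine rotations of the form AND the test vectors cancel);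
relabelling the test vectors by the conjugate of a coarse matrix `V` gives `V·(sandwich A q)·Vᴴ`; and `c‖B‖² ≤ Re B*MB ∀B`
is invariant under `M ↦ VMVᴴ` when `VVᴴ = 1`.  In Bałaban's letters a gauge transformation `u` acts on the covariant
average (3.19) by `R_y(x) ↦ R(u(y))R_y(x)R(u(x))ᵀ` = a fine rotation (index `x`) composed with a coarse relabelling
(index `y`), so the three lemmas together are (g).  (§2) with `h b y ≤ H` and `#{b : src b = x} ≤ d` the inflated Schur
sums are `≤ θ₁ + H·S₁` (rows) and `≤ θ₂ + H·d·S₂` (columns), whence `coarse_coercive_cov_uniform`.  (§3) a flat one-bond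
instance discharging EVERY hypothesis shape of `coarse_coercive_cov` (transporter, holonomy and Gram ones included).
Nothing of Bałaban's operators is instantiated; NO class change on any GAPS row (G-B9-15 decomposed, not closed); readiness
width 0 unchanged; D4 DISCHARGE NO DATE; NOT summit progress.  Unit `b2b-balaban-beta-an4-g40` (owner lineage of
`BINDER-OWNERS.md` row D4); `GAPS.md` C-an4-115.

CITATION HEADER (lean-in-tree rule).  [13] = T. Bałaban, *Propagators for lattice gauge theories in a background field*,
Commun. Math. Phys. **99**, 389–434 (1985) [Balaban1985BackgroundPropagators]; p. 396 [PDF 8] (3.33)–(3.34) verbatim (as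
quoted in NOTE-I3 v1.1 §5.2 from the render `HOME/b2b-balaban-ref1/pages/1985-cmp99-background-propagators/…-p008-x2.png`,
READ AS IMAGE 2026-08-20 by gen 39 of this lineage): *"G′(U^u) = R(u)G′(U)R(u⁻¹), R(U^u) = R(u)R(U)R(u⁻¹) … Δ_a(U^u) =
R(u)Δ_a(U)R(u⁻¹), G(U^u) = R(u)G(U)R(u⁻¹)"*; (3.35): *"for an arbitrary cube □ of the described above class, and for a
configuration U there exists a gauge transformation u on □ such that U^u = e^{iηA}, and if the index of □ is j, then
|A| < O(1)Mα₀(L^jη)⁻¹, |∇^ηA| < O(1)Mα₀(L^jη)⁻² on □"*.  LOCATOR only; nothing printed is asserted.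

WHAT IS CERTIFIED HERE (kernel, sorry-free; [folklore]).
§1 **`sandwich_gauge`** (`UᴴU = 1` ⟹ `sandwich (U A Uᴴ) (fun y => U q_y) = sandwich A q`), **`sandwich_relabel`**
   (`sandwich A (Σ_{y′} conj(V y y′)·q_{y′}) = V·sandwich A q·Vᴴ`), `nsq_conjTranspose_mulVec`,
   **`reCoercive_conj_unitary`** (`VVᴴ = 1`: Re-coercivity with constant `c` passes from `M` to `VMVᴴ`).
§2 `rowSum_inflated_le`, `colSum_inflated_le` (fibrewise count over `src`), **`coarse_coercive_cov_uniform`**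
   (`(δ²∕(μS₁S₂ + (θ₁ + H·S₁)(θ₂ + H·d·S₂)))‖B‖² ≤ Re B*(sandwich A (covFamily s R))B`).
§3 `l2_zero`; non-vacuity: one site, one flat self-bond, trivial fibre — `coarse_coercive_cov` fires with `(1²∕2)‖B‖²`.
NOT CLAIMED.  Any lattice instance; the value of `H` for Bałaban's fields ((3.35) + [5] (52)–(53), O.2-level); the
multiscale form (s); anything about Bałaban's operators; k-uniformity.  NOT summit progress.
PRIOR ART IN THE TREE (searched 2026-08-20: `lean search 'reCoercive|sandwich_.*conj|gauge.*sandwich|unitary.*coerciv'`):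
`B13GaugeDevices.sandwich_conj` (the SAME algebra in B13 (2.5)'s REAL-matrix currency: `(R₁BR₂ᵀ)ᵀ(R₁AR₁ᵀ)⁻¹(R₁BR₂ᵀ) =
R₂(BᵀA⁻¹B)R₂ᵀ` under `R₁ᵀR₁ = 1`, `IsUnit A.det` — fine and coarse rotation in one statement; here: the complex
`sandwich A q` currency of the (I3) chain, NO invertibility hypothesis, plus the coercivity transfer);
`B4Lemma22HolderBox.gauge_sandwich_mulVec` (orthogonal `g(x)g(x′)ᵀ` acting on vectors — a different «sandwich»); d4-p3's
`AccretiveCombesThomas.isUnit_of_reCoercive` ∕ gen 39's `AnalyticWalkSum216RowConstrainedCoercive.reCoercive_*`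
(Re-coercivity as a datum — no conjugation invariance).  No coercivity-transfer-under-conjugation lemma in the tree.
-/

namespace Summit.QuantumFields.BalabanUV.Beta.CoarseCoerciveCovariantGauge

open scoped BigOperators Matrix ComplexConjugate
open Finset Matrix
open Summit.QuantumFields.BalabanUV.Beta.AccretiveCombesThomasSandwich (sandwich)
open Summit.QuantumFields.BalabanUV.Beta.UnitLatticeResolventWalk (Qm superpose)
open Summit.QuantumFields.BalabanUV.Beta.CoarseCoerciveTransport (covFamily)
open Summit.QuantumFields.BalabanUV.Beta.CoarseCoerciveCovariantEnergy (l2 l2_nonneg cpx cpx_one cpx_sub covDiff hol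
  coarse_coercive_cov)
open Literature.MathematicalPhysics.QuantumFieldTheory.Balaban1983to89.B5Prop11Lower (nsq nsq_nonneg
  star_dotProduct_self)

noncomputable section

variable {X Y : Type*} [Fintype X] [Fintype Y] [DecidableEq X] [DecidableEq Y]

/-! ## §1 Gauge covariance of the sandwich and invariance of coercivity constants -/

omit [Fintype Y] [DecidableEq Y] in
/-- **FINE GAUGE ROTATIONS DO NOT CHANGE THE SANDWICH**: for `U` with `UᴴU = 1`, transforming the fine form
`A ↦ U A Uᴴ` and every test vector `q_y ↦ U q_y` leaves `Q A⁻¹ Q*` entry for entry unchanged.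
[cite: Balaban1985BackgroundPropagators, (3.32)–(3.34) p.396] -/
theorem sandwich_gauge (A U : Matrix X X ℂ) (hU : Uᴴ * U = 1) (q : Y → X → ℂ) :
    sandwich (U * A * Uᴴ) (fun y => U *ᵥ q y) = sandwich A q := by
  ext y y'
  have hinv : (U * A * Uᴴ)⁻¹ = U * A⁻¹ * Uᴴ := by
    rw [Matrix.mul_inv_rev, Matrix.mul_inv_rev, Matrix.inv_eq_right_inv hU, Matrix.inv_eq_left_inv hU,
      Matrix.mul_assoc]
  simp only [sandwich]
  rw [hinv, Matrix.mulVec_mulVec, Matrix.mul_assoc, hU, Matrix.mul_one, ← Matrix.mulVec_mulVec, Matrix.star_mulVec,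
    Matrix.dotProduct_mulVec, Matrix.vecMul_vecMul, hU, Matrix.vecMul_one]

omit [Fintype Y] [DecidableEq Y] in
/-- **COARSE RELABELLING CONJUGATES THE SANDWICH**: recombining the test vectors by (the conjugate of) a matrix `V`,
`q′_y = Σ_{y′} conj(V y y′)·q_{y′}`, gives `sandwich A q′ = V·(sandwich A q)·Vᴴ`. [folklore] -/
theorem sandwich_relabel [Fintype Y] (A : Matrix X X ℂ) (q : Y → X → ℂ) (V : Matrix Y Y ℂ) :
    sandwich A (fun y x => ∑ y', star (V y y') * q y' x) = V * sandwich A q * Vᴴ := by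
  ext y y'
  simp only [sandwich, Matrix.mul_apply, Matrix.conjTranspose_apply]
  have hq : ∀ z : Y, (fun x => ∑ y₁, star (V z y₁) * q y₁ x) = ∑ y₁, star (V z y₁) • q y₁ := by
    intro z; ext x; simp [Finset.sum_apply, Pi.smul_apply, smul_eq_mul]
  rw [hq y, hq y', star_sum, Matrix.mulVec_sum, sum_dotProduct]
  simp_rw [dotProduct_sum, Finset.sum_mul]
  rw [Finset.sum_comm]
  refine Finset.sum_congr rfl fun y₂ _ => Finset.sum_congr rfl fun y₁ _ => ?_
  rw [star_smul, star_star, Matrix.mulVec_smul, smul_dotProduct, dotProduct_smul, smul_eq_mul, smul_eq_mul]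
  ring

omit [Fintype X] [DecidableEq X] in
/-- `nsq` is invariant under `B ↦ VᴴB` when `V·Vᴴ = 1`. [folklore] -/
theorem nsq_conjTranspose_mulVec (V : Matrix Y Y ℂ) (hV : V * Vᴴ = 1) (B : Y → ℂ) : nsq (Vᴴ *ᵥ B) = nsq B := by
  have h : star (Vᴴ *ᵥ B) ⬝ᵥ (Vᴴ *ᵥ B) = star B ⬝ᵥ B := by
    rw [Matrix.star_mulVec, Matrix.conjTranspose_conjTranspose, Matrix.dotProduct_mulVec, Matrix.vecMul_vecMul, hV,
      Matrix.vecMul_one]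
  have := congrArg Complex.re h
  rwa [star_dotProduct_self, star_dotProduct_self, Complex.ofReal_re, Complex.ofReal_re] at this

omit [Fintype X] [DecidableEq X] in
/-- **COERCIVITY CONSTANTS ARE INVARIANT UNDER UNITARY CONJUGATION**: if `c‖B‖² ≤ Re B*MB` for all `B` and `V·Vᴴ = 1`,
then `c‖B‖² ≤ Re B*(V M Vᴴ)B` for all `B`.  With `sandwich_gauge` + `sandwich_relabel`: the coercivity of Bałaban's
`Q_jG(□̃)Q_j*` may be computed in ANY gauge, e.g. the cube-wise gauge of (3.35) — leaf (g) of NOTE-I3 §5.2.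
[cite: Balaban1985BackgroundPropagators, (3.32)–(3.35) p.396] -/
theorem reCoercive_conj_unitary (M V : Matrix Y Y ℂ) (hV : V * Vᴴ = 1) {c : ℝ}
    (hM : ∀ B : Y → ℂ, c * nsq B ≤ (star B ⬝ᵥ (M *ᵥ B)).re) (B : Y → ℂ) :
    c * nsq B ≤ (star B ⬝ᵥ ((V * M * Vᴴ) *ᵥ B)).re := by
  have h1 : star B ⬝ᵥ ((V * M * Vᴴ) *ᵥ B) = star (Vᴴ *ᵥ B) ⬝ᵥ (M *ᵥ (Vᴴ *ᵥ B)) := by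
    rw [← Matrix.mulVec_mulVec, ← Matrix.mulVec_mulVec, Matrix.dotProduct_mulVec, Matrix.star_mulVec,
      Matrix.conjTranspose_conjTranspose]
  rw [h1, ← nsq_conjTranspose_mulVec V hV B]
  exact hM _

/-! ## §2 The uniform-holonomy corollary: U = 1 counting data + (H, out-degree) -/

section Uniform

variable {S Cp μ ι : Type*} [Fintype S] [Fintype Cp] [Fintype μ] [Fintype ι] [DecidableEq Cp]

omit [Fintype S] [Fintype Cp] [Fintype ι] [DecidableEq Cp] in
/-- Row sums of the inflated majorant: `Σ_y (|Δ_b t_y| + |t_y(src b)|·h b y) ≤ θ₁ + H·S₁` when `h ≤ H` (`H ≥ 0`),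
`Σ_y |Δ_b t_y| ≤ θ₁` and the overlap at `src b` is `≤ S₁`. [folklore] -/
theorem rowSum_inflated_le (t : μ → S → ℝ) (src tgt : ι → S) (h : ι → μ → ℝ) {H θ₁ S₁ : ℝ} (hH0 : 0 ≤ H)
    (hh : ∀ b y, h b y ≤ H) (hθ₁ : ∀ b, ∑ y, |t y (tgt b) - t y (src b)| ≤ θ₁) (hS₁ : ∀ x, ∑ y, |t y x| ≤ S₁)
    (b : ι) : ∑ y, (|t y (tgt b) - t y (src b)| + |t y (src b)| * h b y) ≤ θ₁ + H * S₁ := by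
  rw [Finset.sum_add_distrib]
  refine add_le_add (hθ₁ b) ?_
  calc ∑ y, |t y (src b)| * h b y ≤ ∑ y, |t y (src b)| * H :=
        Finset.sum_le_sum fun y _ => mul_le_mul_of_nonneg_left (hh b y) (abs_nonneg _)
    _ ≤ H * S₁ := by rw [← Finset.sum_mul, mul_comm]; exact mul_le_mul_of_nonneg_left (hS₁ _) hH0

omit [Fintype Cp] [Fintype μ] [DecidableEq Cp] in
/-- Column sums of the inflated majorant: `Σ_b (|Δ_b t_y| + |t_y(src b)|·h b y) ≤ θ₂ + H·d·S₂` when `h ≤ H` (`H ≥ 0`),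
`Σ_b |Δ_b t_y| ≤ θ₂`, every site is the source of at most `d` bonds and the profile mass is `≤ S₂`. [folklore] -/
theorem colSum_inflated_le [DecidableEq S] (t : μ → S → ℝ) (src tgt : ι → S) (h : ι → μ → ℝ) {H θ₂ S₂ : ℝ}
    {d : ℕ} (hH0 : 0 ≤ H) (hh : ∀ b y, h b y ≤ H) (hθ₂ : ∀ y, ∑ b, |t y (tgt b) - t y (src b)| ≤ θ₂)
    (hdeg : ∀ x, (Finset.univ.filter fun b => src b = x).card ≤ d) (hS₂ : ∀ y, ∑ x, |t y x| ≤ S₂) (y : μ) :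
    ∑ b, (|t y (tgt b) - t y (src b)| + |t y (src b)| * h b y) ≤ θ₂ + H * (d * S₂) := by
  rw [Finset.sum_add_distrib]
  refine add_le_add (hθ₂ y) ?_
  have hfib : ∑ b, |t y (src b)| = ∑ x, ((Finset.univ.filter fun b => src b = x).card : ℝ) * |t y x| := by
    rw [← Finset.sum_fiberwise Finset.univ src fun b => |t y (src b)|]
    refine Finset.sum_congr rfl fun x _ => ?_
    rw [Finset.sum_congr rfl fun b (hb : b ∈ Finset.univ.filter fun b => src b = x) => by
      rw [(Finset.mem_filter.1 hb).2], Finset.sum_const, nsmul_eq_mul]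
  have hS0 : 0 ≤ S₂ := (Finset.sum_nonneg fun x _ => abs_nonneg (t y x)).trans (hS₂ y)
  calc ∑ b, |t y (src b)| * h b y ≤ ∑ b, |t y (src b)| * H :=
        Finset.sum_le_sum fun b _ => mul_le_mul_of_nonneg_left (hh b y) (abs_nonneg _)
    _ = H * ∑ x, ((Finset.univ.filter fun b => src b = x).card : ℝ) * |t y x| := by
        rw [← Finset.sum_mul, mul_comm, hfib]
    _ ≤ H * ∑ x, (d : ℝ) * |t y x| := mul_le_mul_of_nonneg_left (Finset.sum_le_sum fun x _ =>
        mul_le_mul_of_nonneg_right (by exact_mod_cast hdeg x) (abs_nonneg _)) hH0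
    _ ≤ H * (d * S₂) := by
        rw [← Finset.mul_sum]
        exact mul_le_mul_of_nonneg_left (mul_le_mul_of_nonneg_left (hS₂ y) (Nat.cast_nonneg d)) hH0

/-- **COARSE COERCIVITY FOR A BACKGROUND FIELD WITH A UNIFORM HOLONOMY BOUND**: the U = 1 counting data
`(S₁, S₂, θ₁, θ₂)` of the in-block profile, a uniform bound `H` on the thin-loop holonomy defect and an out-degree bound `d`
give `(δ²∕(μS₁S₂ + (θ₁ + H·S₁)(θ₂ + H·d·S₂)))·‖B‖² ≤ Re B*(Q A⁻¹ Q*)B` — at `H = 0` the U = 1 constant, in general the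
U = 1 slope data inflated by `(1 + H·S₁∕θ₁)(1 + H·d·S₂∕θ₂)`: the `(1 + O(1)Mα₀)²`-type uniformity of NOTE-I3 §5.2 (e2).
[cite: Balaban1985BackgroundPropagators, (3.19) p.393, (3.35) p.396] -/
theorem coarse_coercive_cov_uniform [DecidableEq S] [DecidableEq μ] (A : Matrix (S × Cp) (S × Cp) ℂ)
    (hHm : A.IsHermitian) (hU : IsUnit A) (hpsd : ∀ g : S × Cp → ℂ, 0 ≤ (star g ⬝ᵥ (A *ᵥ g)).re) (src tgt : ι → S)
    (W : ι → Matrix Cp Cp ℝ) {μ0 : ℝ} (hμ : 0 ≤ μ0)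
    (hA : ∀ z : S × Cp → ℂ, (star z ⬝ᵥ (A *ᵥ z)).re ≤ μ0 * nsq z + nsq (covDiff src tgt W *ᵥ z))
    (t s : μ → S → ℝ) (hdisj : ∀ y y' x, y ≠ y' → t y x * s y' x = 0) (R : μ → S → Matrix Cp Cp ℝ)
    (hR : ∀ y x, R y x * (R y x)ᵀ = 1) (hW : ∀ b, (W b)ᵀ * W b = 1) {δ : ℝ} (hδ0 : 0 < δ)
    (hδ : ∀ y, δ ≤ ∑ x, t y x * s y x) (h : ι → μ → ℝ) (hh : ∀ b y, 0 ≤ h b y) {H : ℝ} (hH0 : 0 ≤ H)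
    (hhH : ∀ b y, h b y ≤ H) (hhol : ∀ b y v, l2 (cpx (hol src tgt W R b y - 1) *ᵥ v) ≤ h b y * l2 v)
    {d : ℕ} (hdeg : ∀ x, (Finset.univ.filter fun b => src b = x).card ≤ d) {S₁ S₂ θ₁ θ₂ : ℝ} (hS0 : 0 ≤ S₁)
    (hS₁ : ∀ x, ∑ y, |t y x| ≤ S₁) (hS₂ : ∀ y, ∑ x, |t y x| ≤ S₂) (hθ0 : 0 ≤ θ₁)
    (hθ₁ : ∀ b, ∑ y, |t y (tgt b) - t y (src b)| ≤ θ₁) (hθ₂ : ∀ y, ∑ b, |t y (tgt b) - t y (src b)| ≤ θ₂)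
    (hE : 0 < μ0 * (S₁ * S₂) + (θ₁ + H * S₁) * (θ₂ + H * (d * S₂))) (B : μ × Cp → ℂ) :
    δ ^ 2 / (μ0 * (S₁ * S₂) + (θ₁ + H * S₁) * (θ₂ + H * (d * S₂))) * nsq B ≤
      (star B ⬝ᵥ (sandwich A (covFamily s R) *ᵥ B)).re :=
  coarse_coercive_cov A hHm hU hpsd src tgt W hμ hA t s hdisj R hR hW hδ0 hδ h hh hhol hS0 hS₁ hS₂
    (add_nonneg hθ0 (mul_nonneg hH0 hS0)) (rowSum_inflated_le t src tgt h hH0 hhH hθ₁ hS₁)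
    (colSum_inflated_le t src tgt h hH0 hhH hθ₂ hdeg hS₂) hE B

end Uniform

/-! ## §3 Non-vacuity: one site, one flat self-bond, trivial fibre -/

/-- `l2 0 = 0`. [folklore] -/
theorem l2_zero {Cp : Type*} [Fintype Cp] : l2 (0 : Cp → ℂ) = 0 := by
  rw [l2, WithLp.toLp_zero, norm_zero]

/-- One fine site with trivial fibre, ONE self-bond with the flat transporter `W = 1`, transport `R = 1` (so `hol = 1`,
`h = 0`), profile = weight = `1`, `A = 2`, Gram domination with `μ = 2`: `S₁ = S₂ = 1`, `θ₁ = θ₂ = 0`, `δ = 1`, and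
`coarse_coercive_cov` gives `(1²∕(2·1 + 0·0))‖B‖² ≤ Re B*(sandwich A q)B` — every hypothesis shape is jointly
satisfiable, including the transporter and holonomy ones. [folklore] -/
example (B : Unit × Unit → ℂ) :
    (1 : ℝ) ^ 2 / (2 * (1 * 1) + 0 * 0) * nsq B ≤
      (star B ⬝ᵥ (sandwich ((2 : ℂ) • (1 : Matrix (Unit × Unit) (Unit × Unit) ℂ))
        (covFamily (fun (_ : Unit) (_ : Unit) => (1 : ℝ)) fun _ _ => (1 : Matrix Unit Unit ℝ)) *ᵥ B)).re := by
  have hH : ((2 : ℂ) • (1 : Matrix (Unit × Unit) (Unit × Unit) ℂ)).IsHermitian := by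
    rw [Matrix.IsHermitian, Matrix.conjTranspose_smul, Matrix.conjTranspose_one]
    norm_num
  have hU : IsUnit ((2 : ℂ) • (1 : Matrix (Unit × Unit) (Unit × Unit) ℂ)) := by
    rw [Matrix.isUnit_iff_isUnit_det, Matrix.det_smul, Matrix.det_one, mul_one, Fintype.card_prod, Fintype.card_unit,
      mul_one, pow_one]
    exact isUnit_iff_ne_zero.2 two_ne_zero
  have hform : ∀ z : Unit × Unit → ℂ, (star z ⬝ᵥ (((2 : ℂ) • (1 : Matrix (Unit × Unit) (Unit × Unit) ℂ)) *ᵥ z)).re =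
      2 * nsq z := fun z => by
    rw [Matrix.smul_mulVec, Matrix.one_mulVec, dotProduct_smul, smul_eq_mul, star_dotProduct_self,
      show (2 : ℂ) * ((nsq z : ℝ) : ℂ) = ((2 * nsq z : ℝ) : ℂ) by push_cast; ring, Complex.ofReal_re]
  have hhol : ∀ (b y : Unit) (v : Unit → ℂ), l2 (cpx (hol (fun _ : Unit => ()) (fun _ => ()) (fun _ => (1 : Matrix Unit Unit ℝ))
      (fun (_ : Unit) (_ : Unit) => (1 : Matrix Unit Unit ℝ)) b y - 1) *ᵥ v) ≤ 0 * l2 v := by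
    intro b y v
    have : hol (fun _ : Unit => ()) (fun _ => ()) (fun _ => (1 : Matrix Unit Unit ℝ))
        (fun (_ : Unit) (_ : Unit) => (1 : Matrix Unit Unit ℝ)) b y = 1 := by simp [hol]
    rw [this, sub_self, show cpx (0 : Matrix Unit Unit ℝ) = 0 from map_zero _, Matrix.zero_mulVec, l2_zero, zero_mul]
  refine coarse_coercive_cov _ hH hU (fun g => by rw [hform]; exact mul_nonneg zero_le_two (nsq_nonneg g))
    (fun _ : Unit => ()) (fun _ => ()) (fun _ => (1 : Matrix Unit Unit ℝ)) zero_le_two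
    (fun z => by rw [hform]; linarith [nsq_nonneg (covDiff (fun _ : Unit => ()) (fun _ => ())
      (fun _ => (1 : Matrix Unit Unit ℝ)) *ᵥ z)])
    (fun _ _ => (1 : ℝ)) (fun _ _ => (1 : ℝ)) (fun y y' _ hy => (hy (Subsingleton.elim y y')).elim)
    (fun _ _ => (1 : Matrix Unit Unit ℝ)) (fun _ _ => by simp) (fun _ => by simp) one_pos (fun _ => by simp)
    (fun _ _ => (0 : ℝ)) (fun _ _ => le_rfl) hhol zero_le_one (fun _ => by simp) (fun _ => by simp) le_rfl
    (fun _ => by simp) (fun _ => by simp) (by norm_num) B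

end

end Summit.QuantumFields.BalabanUV.Beta.CoarseCoerciveCovariantGauge
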